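import Summits.QuantumFields.YangMills.Theorems.BalabanUVNodesRateCarriersOfRecord13
import Literature.MathematicalPhysics.QuantumFieldTheory.Balaban1983to89.T4BetaReadOutLipschitz

/-!
# BalabanUVNodes ∕ N27 = binder B5 — THE FIRST PRODUCER OF THE (D4) READ-OUT BINDER `YMDAG.UVSplit.ReadOutAt D u`, in the landed PROBES currency of
# `T4BetaReadOutLipschitz` §3, and its instance at node U3's bundle of record `u3OfRecord₁₃ θ uo k` (window clause FREE, letter signs from `uo.Signs`)

Cell `pub-ymgap` (HUMAN RULING D-0062 Track A; director-ym №197 ∕ HUMAN RULING D-0149 work-bound push), width seat `pub-ymgap-dag-n27-w1` (gen 0) on NODE n27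
(B5 composite); W-SEAT START LIST v2 §2 «n27 B5 composite» ITEM 1: of the K4 rate slots of dag-n27-c's leaf C `…N27SpineGivenEndpointR13SepCoPHProducers`
(p576169) ∕ leaf F, every slot reads a PRODUCER's landed currency EXCEPT (D4), which is the bare binder
`hD4 : … ReadOutAt (datumOfRecord₁₃CoPH F 2 θ hP) (u3OfRecord₁₃ θ.toStage13Params (…).u3Objects θ.γ) k)`; the tree had CONSUMERS of `ReadOutAt` only
(`YMDAG.UVSplit.n17At_of_u3`, `YMDAG.N17.n17At_of_readOutAt`, `N19InEdgesAtRecord.histCompanions_of_readOutAt`) and no constructor.  Filed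
`--kind proof --supports stmt-QuantumFields-20544 --as helper` (K3⁷ `SpineGivenEndpointR13SepCoPH`); COUNT-NEUTRAL.  [I] = [Balaban1987RG1].

WHAT IS KERNEL-CHECKED (theorems only; 0 `def`, 0 `sorry`, standard axioms).
* §1 `readOutAt_of_probes` — **(D4) PRODUCED from a finite PROBE RECIPE** `PB : Probes u.C u.C.BgB V ι` (run B) and its transport `PB.transportTo` (run A):
  the ∃-witnesses of `ReadOutAt D u` are `𝒜A := PB.transportTo.Analytic α`, `𝒜B := PB.Analytic α`, `rA := PB.transportTo.recipe`, `rB := PB.recipe`; the two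
  UNPRINTED read-out binders `ReadBoundedOn` ∕ `ReadCovariantOn` are DISCHARGED by `Probes.readBoundedOn_recipe` ∕ `Probes.readCovariantOn_recipe` (the Cauchy
  estimate [I] (4.3)–(4.5) + the locality sum) at the located constant `8K∕α²`, enlarged to the bundle's letter `u.cr` under the displayed `8K∕α² ≤ u.cr`
  (`Probes.localitySum_mono`); `0 ≤ u.cr` then follows from `Probes.localitySum_nonneg`.  What stays DISPLAYED: the window∕box clause, `RepresentsA∕B` (the
  datum's β-function IS the recipe's read-out of the functionals, [I] (1.20)–(1.22) p. 264), the (1.17)∕(4.4)-type analyticity of the slices on the window,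
  `LocalitySum`, non-empty probe sets, and the four remaining letter signs.
* §2 `readOutAt_u3OfRecord₁₃_of_probes` — the same AT NODE U3's BUNDLE OF RECORD `u3OfRecord₁₃ θ uo k` (`Thm/BalabanUVNodesRateCarriersOfRecord13`): its window
  IS `Window θ.γ` with radius `θ.γ`, so the box clause is FREE (`T4BetaReadOut.extd_mem_window`), and the five signs are the object block's `uo.Signs`; the
  keyed family form `forall_readOutAt_u3OfRecord₁₃_of_probes` is the shape of leaf C∕F's `hD4` binder for ANY parameter type `Θ F` over `Stage13Params` (`toS`,
  e.g. `Stage13HParams.toStage13Params`), ANY key `P`, ANY datum key `Dk` and ANY object reading `uo` (`N`-generic, guard-generic: instantiate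
  `P F θ := θ.Provisos₁₃CoPH F N ∧ guard ∧ θ.Admissible F N`, `Dk := datumOfRecord₁₃CoPH …`, `uo F θ := (…ofRecordAdm…).u3Objects θ.γ`).
* NOT HERE (one declarer per statement, dag-lead DEDUP-354 ADJACENCY-2): the (q3) junk test «(D4) with a box-blind functional forces a box-constant β» is
  dag-n18-w2's (`…N18U3TowerGuards`, `boxwiseConstant_of_readOutAt_blind`) ∕ dag-n17-w2's (`…N17D4ReadOutAtRecord13` §2); the four-binder REDUCTION of (D4) at
  the bundle of record is dag-n17-w2's §1.  This file is the PROBES-currency producer only.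

HONEST FRAMING.  [bookkeeping ∕ folklore]: ∃-packaging of the tree's recipe theorems; NO estimate of Bałaban's is proved or asserted; the
analytic inputs of (D4) (representation of the datum's β-functions by the recipe, slice analyticity, the locality sum `K`, non-empty probe sets) remain
HYPOTHESES inhabited for no family today; NE4 ∕ NE5 ∕ NE9 NOT PRINTED for d = 4 and NOT proved; nothing instantiated at Bałaban's objects; no
`Provisos₁₃CoPH` inhabitant claimed (K0⁷ open); N17 ∕ N27 NOT discharged; K3⁷ NOT claimed; route rev 25 and the skeleton of record UNTOUCHED; counts UNMOVED
(typed 28∕28 · discharged 5∕27, A 5∕28); one finite four-torus programme at fixed `ε` — R4 closes the conditional rung `BalabanLadder.UV` only: NOT ℝ⁴, NOT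
infinite volume, NOT OS, NOT a mass gap, NOT Clay.  No decl below carries a cite tag.
-/

namespace Summit.QuantumFields.YangMills.BalabanUVNodes.N27ReadOutAtOfProbes

open Literature.MathematicalPhysics.QuantumFieldTheory.Balaban1983to89
open Literature.MathematicalPhysics.QuantumFieldTheory.Balaban1983to89.T4Continuum
open Literature.MathematicalPhysics.QuantumFieldTheory.Balaban1983to89.T4OutputRate (Carriers Functional Window)
open Literature.MathematicalPhysics.QuantumFieldTheory.Balaban1983to89.T4BetaReadOut (Slice ReadOut RepresentsA RepresentsB extd_mem_window)
open Literature.MathematicalPhysics.QuantumFieldTheory.Balaban1983to89.T4BetaReadOutLipschitz (ReadBoundedOn ReadCovariantOn Probes)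
open Literature.MathematicalPhysics.QuantumFieldTheory.Balaban1983to89.T4FlagMemory (extd)
open Literature.MathematicalPhysics.QuantumFieldTheory.Balaban1983to89.FlowStep (Box HBeta)
open YMDAG.UVSplit
open Node00 (Stage13Params U3Objects₁₁)

variable {F : T4Family} {N : ℕ} [NeZero N]

/-! ## §1 (D4) produced from a probe recipe -/

section Generic

variable {V : Type*} [NormedAddCommGroup V] [NormedSpace ℂ V] {ι : Type*}

/-- The locality sum is monotone in its constant (`Σ … ≤ K ≤ K'`). [folklore] -/
theorem localitySum_mono {C : Carriers} {Bg : Type} (P : Probes C Bg V ι) {κ K K' : ℝ} (hK : P.LocalitySum κ K) (hKK' : K ≤ K') :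
    P.LocalitySum κ K' :=
  fun k => (hK k).trans hKK'

/-- **(D4) `ReadOutAt D u` PRODUCED FROM A PROBE RECIPE** (run B's probes `PB`, run A's = `PB.transportTo`): the read-out classes are the analytic classes of
radius `α`, the recipes are the probe recipes, `ReadBoundedOn` ∕ `ReadCovariantOn` are the tree's `readBoundedOn_recipe` ∕ `readCovariantOn_recipe` at
`8K∕α²`, enlarged to the letter `u.cr`; everything else is displayed.  NOT a discharge of (D4) at any datum of record: the representation clauses, the
analyticity of the slices and the locality sum are hypotheses. [bookkeeping] -/
theorem readOutAt_of_probes (D : Datum F N) (u : U3Carriers) (PB : Probes u.C u.C.BgB V ι) {α K : ℝ}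
    (hW : ∀ k (v : Fin (k + 1) → ℝ), v ∈ Box u.γ k → extd v ∈ u.W)
    (hA : RepresentsA u.EA PB.transportTo.recipe u.γ D.βfun) (hB : RepresentsB u.EB PB.recipe u.γ D.βfun)
    (hanA : ∀ g ∈ u.W, u.EA g ∈ PB.transportTo.Analytic α)
    (hanB : ∀ b : ℝ, 0 < b → b ≤ u.γ → ∀ g ∈ u.W, u.EB b g ∈ PB.Analytic α)
    (hα : 0 < α) (hK : PB.LocalitySum u.κ K) (hne : ∀ k, (PB.idx k).Nonempty) (hcr : 8 * K / α ^ 2 ≤ u.cr)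
    (hC₅ : 0 ≤ u.C₅) (hθ : 0 ≤ u.θ) (hω : 0 ≤ u.ω) (hθρ : u.θ ≤ u.ρ) (hωρ : u.ω ≤ u.ρ) :
    ReadOutAt D u := by
  have hα2 : 0 < α ^ 2 := pow_pos hα 2
  have h8K : 8 * K ≤ u.cr * α ^ 2 := (div_le_iff₀ hα2).mp hcr
  -- enlarge the locality constant so that `8 K' / α² = u.cr` exactly
  have hKK' : K ≤ u.cr * α ^ 2 / 8 := by
    rw [le_div_iff₀ (by norm_num : (0 : ℝ) < 8)]
    linarith
  have hK' : PB.LocalitySum u.κ (u.cr * α ^ 2 / 8) := localitySum_mono PB hK hKK'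
  have hcr' : 8 * (u.cr * α ^ 2 / 8) / α ^ 2 = u.cr := by
    field_simp
  have hbd : ReadBoundedOn (PB.transportTo.Analytic α) PB.transportTo.recipe u.κ u.cr := by
    have h := PB.transportTo.readBoundedOn_recipe hα hK' hne
    rwa [hcr'] at h
  have hcov : ReadCovariantOn (PB.transportTo.Analytic α) (PB.Analytic α) PB.transportTo.recipe PB.recipe u.κ u.cr := by
    have h := PB.readCovariantOn_recipe hα hK' hne
    rwa [hcr'] at h
  have hcr0 : 0 ≤ u.cr :=
    le_trans (div_nonneg (mul_nonneg (by norm_num) (PB.localitySum_nonneg hK)) hα2.le) hcr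
  exact ⟨PB.transportTo.Analytic α, PB.Analytic α, PB.transportTo.recipe, PB.recipe, hW, hA, hB, hanA, hanB, hbd, hcov, hcr0,
    hC₅, hθ, hω, hθρ, hωρ⟩

end Generic

/-! ## §2 At node U3's bundle of record `u3OfRecord₁₃ θ uo k` -/

section AtRecord

variable {V : Type*} [NormedAddCommGroup V] [NormedSpace ℂ V] {ι : Type*}

/-- **(D4) AT NODE U3's BUNDLE OF RECORD** `u3OfRecord₁₃ θ uo k` (Stage-13 parameters `θ`, U3 objects `uo`, run length `k`), for ANY datum `D`, from a probe
recipe on the level-`k` carriers: the bundle's window IS `Window θ.γ` with radius `θ.γ`, so the box clause is FREE (`extd_mem_window`); the five letter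
signs are `uo.Signs`; the rest as in §1 with `κ = uo.κ`, `cr = uo.cr`.  NOT a discharge. [bookkeeping] -/
theorem readOutAt_u3OfRecord₁₃_of_probes (θ : Stage13Params F N) (uo : U3Objects₁₁) (hs : uo.Signs) (k : ℕ) (D : Datum F N)
    (PB : Probes (uo.levelCarriers k) (uo.levelCarriers k).BgB V ι) {α K : ℝ}
    (hA : RepresentsA (uo.EA k) PB.transportTo.recipe θ.γ D.βfun) (hB : RepresentsB (uo.EB k) PB.recipe θ.γ D.βfun)
    (hanA : ∀ g ∈ Window θ.γ, uo.EA k g ∈ PB.transportTo.Analytic α)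
    (hanB : ∀ b : ℝ, 0 < b → b ≤ θ.γ → ∀ g ∈ Window θ.γ, uo.EB k b g ∈ PB.Analytic α)
    (hα : 0 < α) (hK : PB.LocalitySum uo.κ K) (hne : ∀ j, (PB.idx j).Nonempty) (hcr : 8 * K / α ^ 2 ≤ uo.cr) :
    ReadOutAt D (u3OfRecord₁₃ θ uo k) :=
  readOutAt_of_probes D (u3OfRecord₁₃ θ uo k) PB (fun _ _ hv => extd_mem_window hv) hA hB hanA hanB hα hK hne hcr
    hs.C₅_nonneg hs.θ₅_pos.le hs.ω_nonneg hs.θ₅_le_ρ hs.ω_le_ρ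

/-- **THE KEYED FAMILY FORM** (the shape of leaf C∕F's `hD4` binder): for ANY parameter type `Θ F` read into Stage-13 parameters by `toS` (e.g. def-T's
`Stage13HParams.toStage13Params`), ANY key `P F θ` (e.g. provisos ∧ guard ∧ admissible), ANY datum key `Dk` (e.g. `datumOfRecord₁₃CoPH F N θ hP`) and ANY
object reading `uo F θ` (e.g. node00-def-W1's `(…ofRecordAdm…).u3Objects θ.γ`) with its signs under the key, per-tuple and per-run-length probe data with
the §2 clauses give `ReadOutAt (Dk F θ h) (u3OfRecord₁₃ (toS F θ) (uo F θ) k)` under the key.  NOT a discharge. [bookkeeping] -/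
theorem forall_readOutAt_u3OfRecord₁₃_of_probes {Θ : T4Family → Type*} (toS : (F : T4Family) → Θ F → Stage13Params F N)
    (P : (F : T4Family) → Θ F → Prop) (Dk : (F : T4Family) → (θ : Θ F) → P F θ → Datum F N) (uo : (F : T4Family) → Θ F → U3Objects₁₁)
    (hs : ∀ (F : T4Family) (θ : Θ F), P F θ → (uo F θ).Signs)
    (hprobes : ∀ (F : T4Family) (θ : Θ F) (h : P F θ) (k : ℕ),
      ∃ (V : Type) (_ : NormedAddCommGroup V) (_ : NormedSpace ℂ V) (ι : Type)
        (PB : Probes ((uo F θ).levelCarriers k) ((uo F θ).levelCarriers k).BgB V ι) (α K : ℝ),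
        RepresentsA ((uo F θ).EA k) PB.transportTo.recipe (toS F θ).γ (Dk F θ h).βfun ∧
        RepresentsB ((uo F θ).EB k) PB.recipe (toS F θ).γ (Dk F θ h).βfun ∧
        (∀ g ∈ Window (toS F θ).γ, (uo F θ).EA k g ∈ PB.transportTo.Analytic α) ∧
        (∀ b : ℝ, 0 < b → b ≤ (toS F θ).γ → ∀ g ∈ Window (toS F θ).γ, (uo F θ).EB k b g ∈ PB.Analytic α) ∧
        0 < α ∧ PB.LocalitySum (uo F θ).κ K ∧ (∀ j, (PB.idx j).Nonempty) ∧ 8 * K / α ^ 2 ≤ (uo F θ).cr) :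
    ∀ (F : T4Family) (θ : Θ F) (h : P F θ) (k : ℕ), ReadOutAt (Dk F θ h) (u3OfRecord₁₃ (toS F θ) (uo F θ) k) := by
  intro F θ h k
  obtain ⟨V, _, _, ι, PB, α, K, hA, hB, hanA, hanB, hα, hK, hne, hcr⟩ := hprobes F θ h k
  exact readOutAt_u3OfRecord₁₃_of_probes (toS F θ) (uo F θ) (hs F θ h) k (Dk F θ h) PB hA hB hanA hanB hα hK hne hcr

end AtRecord


end Summit.QuantumFields.YangMills.BalabanUVNodes.N27ReadOutAtOfProbes
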